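import Mathlib

/-!
# Wall bubbling for `DoorA26` — the pure-disjoint sieve (turnkey helper, val-idea-15)

The finite/linear-algebra half of the PURE-DISJOINT WALL LAW of the line
`Cruxes/DoorA26/Lines/wall_bubbling.lean` (stmt-ValiantsHypothesis-19979): at an exponent vector `δ`
with no Weyl (`δ` injective) and no mixed coincidence (`2δᵢ ≠ δₖ + δₗ`), there is NO nonzero blow-up
pattern — no nonzero `6 × 6` matrix which is (up to sign) the Gram matrix of six real symmetric
`2 × 2` letters for the polar form of `det` and whose pair-sum value classes all sum to zero.
The statement inlines the line file's definitions `polar`, `Realisable`, `BlockSumsZero`,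
`HasMixedCoincidence` (no new definitions here), so `Stmt.stub_pureDSieve` there is closed by
`fun δ hδ hm G hB hR => pureDSieve δ hδ hm G hB hR` (definitional unfolding).  `pureDSieve_false_without_noMixed` records that the
no-mixed-coincidence hypothesis cannot be dropped (the first-order MIXED blow-up pattern
`−E₁₁ + ½(E₀₂+E₂₀)` at `2δ₁ = δ₀ + δ₂` is realisable).  Nothing here bears on the truth of `DoorA26`
itself. [this work]

HONEST FRAMING / PROVENANCE.  Turnkey file of ideator val-idea-15 g1 (line «wall-bubbling», `Cruxes/DoorA26/Lines/wall_bubbling.lean`,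
stub `Stmt.stub_pureDSieve`; checked by val-idea-crit-5), ported VERBATIM modulo this paragraph and the linter option below by val-sym-door-p2 g9
(desk R2480 (D), `--supports stmt-ValiantsHypothesis-19979 --as helper`).  Pure linear algebra of the polar form of `det` on `Sym₂(ℝ)`; no new
definitions; nothing here bears on `DoorA26` (OPEN), on `MatrixDescartes` (stmt-ValiantsHypothesis-18050) or on `VP ≠ VNP`.
-/

-- `Summit.ValiantsHypothesis.ValiantsHypothesis.…` repeats a component by the D-0017 layout
-- (single-conjunct summit), which the `dupNamespace` linter flags; the name is mandated.
set_option linter.dupNamespace false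

namespace Summit.ValiantsHypothesis.ValiantsHypothesis.Theorems.LacunarySymmetroidMatrixDescartes.WallBubbling

open Finset Matrix

noncomputable section

/-! ## The polar form on singular symmetric `2 × 2` matrices -/

/-- Entry formula for the polar form. [this work] -/
theorem polar_entries (S T : Matrix (Fin 2) (Fin 2) ℝ) :
    ((S + T).det - S.det - T.det) / 2 = (S 0 0 * T 1 1 + T 0 0 * S 1 1 - S 0 1 * T 1 0 - T 0 1 * S 1 0) / 2 := by
  simp only [Matrix.det_fin_two, Matrix.add_apply]; ring

/-- The polar form is symmetric. [this work] -/
theorem polar_comm (S T : Matrix (Fin 2) (Fin 2) ℝ) :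
    ((S + T).det - S.det - T.det) / 2 = ((T + S).det - T.det - S.det) / 2 := by
  rw [polar_entries, polar_entries]; ring

/-- `polar S S = det S`. [this work] -/
theorem polar_self (S : Matrix (Fin 2) (Fin 2) ℝ) : ((S + S).det - S.det - S.det) / 2 = S.det := by
  rw [polar_entries, Matrix.det_fin_two]; ring

/-- Homogeneity of the polar form in the first slot. [this work] -/
theorem polar_smul_left (c : ℝ) (S T : Matrix (Fin 2) (Fin 2) ℝ) :
    ((c • S + T).det - (c • S).det - T.det) / 2 = c * (((S + T).det - S.det - T.det) / 2) := by
  rw [polar_entries, polar_entries]; simp only [Matrix.smul_apply, smul_eq_mul]; ring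

/-- `polar 0 T = 0`. [this work] -/
theorem polar_zero_left (T : Matrix (Fin 2) (Fin 2) ℝ) :
    (((0 : Matrix (Fin 2) (Fin 2) ℝ) + T).det - (0 : Matrix (Fin 2) (Fin 2) ℝ).det - T.det) / 2 = 0 := by
  rw [polar_entries]; simp

/-- Entry-level core: two singular symmetric `2 × 2` matrices `(a,b,c)`, `(a',b',c')` with vanishing
polar form are proportional when the second is nonzero. [this work] -/
theorem ratio_of_relations (a b c a' b' c' : ℝ) (hE1 : a * c = b * b) (hE2 : a' * c' = b' * b')
    (h3 : a * c' + a' * c = 2 * b * b') (hT0 : ¬ (a' = 0 ∧ b' = 0 ∧ c' = 0)) :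
    ∃ r : ℝ, a = r * a' ∧ b = r * b' ∧ c = r * c' := by
  by_cases hz : a' = 0
  · have hb'0 : b' = 0 := by
      have : b' * b' = 0 := by rw [hz] at hE2; linarith
      exact mul_self_eq_zero.mp this
    have hc'0 : c' ≠ 0 := fun hc0 => hT0 ⟨hz, hb'0, hc0⟩
    have ha0 : a = 0 := by
      have : a * c' = 0 := by rw [hz, hb'0] at h3; linarith
      rcases mul_eq_zero.mp this with h0 | h0
      · exact h0
      · exact absurd h0 hc'0
    have hb0 : b = 0 := by
      have : b * b = 0 := by rw [ha0] at hE1; linarith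
      exact mul_self_eq_zero.mp this
    refine ⟨c / c', ?_, ?_, ?_⟩
    · rw [ha0, hz]; ring
    · rw [hb0, hb'0]; ring
    · field_simp
  · have hsq : (a * b' - a' * b) ^ 2 = 0 := by
      linear_combination (-(a' ^ 2)) * hE1 + (-(a ^ 2)) * hE2 + (a * a') * h3
    have hab : a' * b = a * b' := by
      have := (pow_eq_zero_iff (n := 2) (by norm_num)).mp hsq
      linarith
    have h6 : a' * (a' * c - a * c') = 0 := by
      linear_combination a' * h3 + (2 * b') * hab + (-(2 * a)) * hE2
    have hac : a' * c = a * c' := by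
      rcases mul_eq_zero.mp h6 with h0 | h0
      · exact absurd h0 hz
      · linarith
    refine ⟨a / a', ?_, ?_, ?_⟩
    · field_simp
    · field_simp; linarith
    · field_simp; linarith

/-- Two singular symmetric `2 × 2` matrices with vanishing polar form are proportional (when the second
is nonzero): the null cone of `(Sym₂ℝ, det)` contains no two `det`-orthogonal non-parallel vectors.
[this work] -/
theorem exists_smul_of_polar_eq_zero {S T : Matrix (Fin 2) (Fin 2) ℝ} (hS : S.IsSymm) (hT : T.IsSymm)
    (hdS : S.det = 0) (hdT : T.det = 0) (hT0 : T ≠ 0) (h : ((S + T).det - S.det - T.det) / 2 = 0) :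
    ∃ c : ℝ, S = c • T := by
  have hS10 : S 1 0 = S 0 1 := by
    simpa [Matrix.transpose_apply] using congrFun (congrFun hS 0) 1
  have hT10 : T 1 0 = T 0 1 := by
    simpa [Matrix.transpose_apply] using congrFun (congrFun hT 0) 1
  have hE1 : S 0 0 * S 1 1 = S 0 1 * S 0 1 := by
    rw [Matrix.det_fin_two, hS10] at hdS; linarith
  have hE2 : T 0 0 * T 1 1 = T 0 1 * T 0 1 := by
    rw [Matrix.det_fin_two, hT10] at hdT; linarith
  have h3 : S 0 0 * T 1 1 + T 0 0 * S 1 1 = 2 * S 0 1 * T 0 1 := by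
    rw [polar_entries, hS10, hT10] at h; linarith
  have hT0' : ¬ (T 0 0 = 0 ∧ T 0 1 = 0 ∧ T 1 1 = 0) := by
    rintro ⟨h0, h1, h2⟩
    apply hT0
    ext i j
    fin_cases i <;> fin_cases j <;> simp [h0, h1, h2, hT10]
  obtain ⟨r, h1, h2, h4⟩ :=
    ratio_of_relations (S 0 0) (S 0 1) (S 1 1) (T 0 0) (T 0 1) (T 1 1) hE1 hE2 h3 hT0'
  refine ⟨r, ?_⟩
  ext i j
  fin_cases i <;> fin_cases j <;> simp [Matrix.smul_apply, hS10, hT10, h1, h2, h4]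

/-- Transitivity of `det`-orthogonality through a nonzero null letter. [this work] -/
theorem polar_eq_zero_of_common {S T U : Matrix (Fin 2) (Fin 2) ℝ} (hS : S.IsSymm) (hT : T.IsSymm)
    (hU : U.IsSymm) (hdS : S.det = 0) (hdT : T.det = 0) (hdU : U.det = 0) (hT0 : T ≠ 0)
    (h1 : ((S + T).det - S.det - T.det) / 2 = 0) (h2 : ((U + T).det - U.det - T.det) / 2 = 0) :
    ((S + U).det - S.det - U.det) / 2 = 0 := by
  obtain ⟨c, rfl⟩ := exists_smul_of_polar_eq_zero hS hT hdS hdT hT0 h1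
  obtain ⟨c', rfl⟩ := exists_smul_of_polar_eq_zero hU hT hdU hdT hT0 h2
  rw [polar_smul_left, polar_comm, polar_smul_left, polar_self, hdT]; ring

/-! ## The sieve -/

/-- **Pure-disjoint sieve** (`Stmt.stub_pureDSieve` of the line `wall_bubbling`): at an injective exponent
vector `δ` without mixed coincidences `2δᵢ = δₖ + δₗ`, a matrix `G` which is `±` the Gram matrix of six
symmetric `2 × 2` letters for the polar form `((S+T).det - S.det - T.det)/2` of `det`, and whose pair-sum
value classes `{(k,l) : δₖ + δₗ = v}` all sum to zero, is `0`.
Proof: the diagonal classes are singletons, so every letter is `det`-null; the polar form of two null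
letters vanishes iff they are parallel; the nonzero entry with the largest pair sum and its partner in
the same value class give four distinct letters, and the `δ`-largest of them is `det`-orthogonal, hence
parallel, to both letters of the opposite pair — which are then parallel to each other. [this work] -/
theorem pureDSieve (δ : Fin 6 → ℝ) (hδ : Function.Injective δ)
    (hm : ¬ ∃ i k l : Fin 6, i ≠ k ∧ i ≠ l ∧ k ≠ l ∧ 2 * δ i = δ k + δ l)
    (G : Matrix (Fin 6) (Fin 6) ℝ)
    (hB : ∀ v : ℝ, (∑ k, ∑ l, if δ k + δ l = v then G k l else 0) = 0)
    (hR : ∃ (ε : ℝ) (S : Fin 6 → Matrix (Fin 2) (Fin 2) ℝ), (ε = 1 ∨ ε = -1) ∧ (∀ l, (S l).IsSymm) ∧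
      ∀ i j, G i j = ε * (((S i + S j).det - (S i).det - (S j).det) / 2)) : G = 0 := by
  classical
  obtain ⟨ε, S, hε, hsym, hG⟩ := hR
  have hε0 : ε ≠ 0 := by rcases hε with rfl | rfl <;> norm_num
  have hGs : ∀ i j, G i j = G j i := fun i j => by rw [hG, hG j i, polar_comm]
  -- Step 1: the diagonal vanishes (the class of `2δᵢ` is the singleton `{(i,i)}`).
  have hcl : ∀ i k l, δ k + δ l = δ i + δ i → k = i ∧ l = i := by
    intro i k l hkl
    by_cases hki : k = i
    · subst hki
      exact ⟨rfl, hδ (by linarith)⟩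
    by_cases hli : l = i
    · subst hli
      exact absurd (hδ (by linarith : δ k = δ l)) hki
    by_cases hkl' : k = l
    · subst hkl'
      exact absurd (hδ (by linarith : δ k = δ i)) hki
    · exact absurd ⟨i, k, l, fun h => hki h.symm, fun h => hli h.symm, hkl', by linarith⟩ hm
  have hdiag : ∀ i, G i i = 0 := by
    intro i
    have h := hB (δ i + δ i)
    rw [Finset.sum_eq_single i] at h
    · rw [Finset.sum_eq_single i] at h
      · simpa using h
      · intro l _ hl
        rw [if_neg]
        exact fun hh => hl (hcl i i l hh).2
      · simp
    · intro k _ hk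
      refine Finset.sum_eq_zero fun l _ => ?_
      rw [if_neg]
      exact fun hh => hk (hcl i k l hh).1
    · simp
  -- Step 2: every letter is null; orthogonality through a nonzero null letter is transitive.
  have hdet : ∀ i, (S i).det = 0 := by
    intro i
    have h := hdiag i
    rw [hG, polar_self] at h
    rcases mul_eq_zero.mp h with h0 | h0
    · exact absurd h0 hε0
    · exact h0
  have hpol : ∀ k a, G k a = 0 → ((S k + S a).det - (S k).det - (S a).det) / 2 = 0 := by
    intro k a h
    rw [hG] at h
    rcases mul_eq_zero.mp h with h0 | h0
    · exact absurd h0 hε0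
    · exact h0
  have hne : ∀ k l, G k l ≠ 0 → S k ≠ 0 := by
    intro k l hkl hk0
    apply hkl
    rw [hG, hk0, polar_zero_left, mul_zero]
  have htrans : ∀ k l a, G k a = 0 → G l a = 0 → S a ≠ 0 → G k l = 0 := by
    intro k l a hka hla ha
    rw [hG, polar_eq_zero_of_common (hsym k) (hsym a) (hsym l) (hdet k) (hdet a) (hdet l) ha
      (hpol k a hka) (hpol l a hla), mul_zero]
  -- Step 3: the extremal core.
  have core : ∀ a b a' b' : Fin 6, G a b ≠ 0 → G a' b' ≠ 0 → δ a + δ b = δ a' + δ b' →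
      (∀ q : Fin 6 × Fin 6, G q.1 q.2 ≠ 0 → δ q.1 + δ q.2 ≤ δ a + δ b) →
      δ a' < δ a → δ b' < δ a → False := by
    intro a b a' b' hab ha'b' hsum hmax h1 h2
    have hGaa' : G a a' = 0 := by
      by_contra h
      have := hmax (a, a') h
      simp only at this
      linarith
    have hGab' : G a b' = 0 := by
      by_contra h
      have := hmax (a, b') h
      simp only at this
      linarith
    exact ha'b' (htrans a' b' a (by rw [hGs]; exact hGaa') (by rw [hGs]; exact hGab') (hne a b hab))
  -- Step 4: the nonzero entry with the largest pair sum, and its class partner.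
  by_contra hG0
  have hex : ∃ p : Fin 6 × Fin 6, G p.1 p.2 ≠ 0 := by
    by_contra hall
    push Not at hall
    apply hG0
    ext i j
    simpa using hall (i, j)
  obtain ⟨p0, hp0⟩ := hex
  obtain ⟨⟨k, l⟩, hp, hmax⟩ := Finset.exists_max_image
    (Finset.univ.filter fun p : Fin 6 × Fin 6 => G p.1 p.2 ≠ 0) (fun p => δ p.1 + δ p.2)
    ⟨p0, Finset.mem_filter.mpr ⟨Finset.mem_univ _, hp0⟩⟩
  rw [Finset.mem_filter] at hp
  have hp : G k l ≠ 0 := hp.2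
  have hmax' : ∀ q : Fin 6 × Fin 6, G q.1 q.2 ≠ 0 → δ q.1 + δ q.2 ≤ δ k + δ l := fun q hq => by
    simpa using hmax q (Finset.mem_filter.mpr ⟨Finset.mem_univ _, hq⟩)
  have hkl : k ≠ l := by
    rintro rfl
    exact hp (hdiag k)
  have hother : ∃ k' l', δ k' + δ l' = δ k + δ l ∧ (k', l') ≠ (k, l) ∧ (k', l') ≠ (l, k) ∧
      G k' l' ≠ 0 := by
    by_contra hno
    push Not at hno
    have hB' : ∑ q : Fin 6 × Fin 6, (if δ q.1 + δ q.2 = δ k + δ l then G q.1 q.2 else 0) = 0 := by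
      rw [← Finset.univ_product_univ, Finset.sum_product]
      exact hB _
    rw [Finset.sum_eq_add (k, l) (l, k) (fun h => hkl (Prod.ext_iff.mp h).1)] at hB'
    · simp only [add_comm (δ l) (δ k), if_true] at hB'
      rw [hGs l k] at hB'
      exact hp (by linarith)
    · intro c _ hc
      by_cases h : δ c.1 + δ c.2 = δ k + δ l
      · rw [if_pos h]
        exact hno c.1 c.2 h (by rw [Prod.mk.eta]; exact hc.1) (by rw [Prod.mk.eta]; exact hc.2)
      · rw [if_neg h]
    · simp
    · simp
  obtain ⟨k', l', hcls, hne1, hne2, hp'⟩ := hother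
  -- the two pairs are disjoint
  have hk'k : k' ≠ k := by
    intro h
    apply hne1
    rw [h] at hcls ⊢
    rw [hδ (by linarith : δ l' = δ l)]
  have hk'l : k' ≠ l := by
    intro h
    apply hne2
    rw [h] at hcls ⊢
    rw [hδ (by linarith : δ l' = δ k)]
  have hl'k : l' ≠ k := by
    intro h
    apply hne2
    rw [h] at hcls ⊢
    rw [hδ (by linarith : δ k' = δ l)]
  have hl'l : l' ≠ l := by
    intro h
    apply hne1
    rw [h] at hcls ⊢
    rw [hδ (by linarith : δ k' = δ k)]
  -- Step 5: the δ-largest of the four letters.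
  obtain ⟨m, hmem, hmx⟩ := Finset.exists_max_image ({k, l, k', l'} : Finset (Fin 6)) δ ⟨k, by simp⟩
  have bk : δ k ≤ δ m := hmx k (by simp)
  have bl : δ l ≤ δ m := hmx l (by simp)
  have bk' : δ k' ≤ δ m := hmx k' (by simp)
  have bl' : δ l' ≤ δ m := hmx l' (by simp)
  have strict : ∀ x y : Fin 6, x ≠ y → δ x ≤ δ y → δ x < δ y := fun x y hxy hle =>
    lt_of_le_of_ne hle fun h => hxy (hδ h)
  simp only [Finset.mem_insert, Finset.mem_singleton] at hmem
  rcases hmem with h | h | h | h <;> rw [h] at bk bl bk' bl'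
  · exact core k l k' l' hp hp' hcls.symm hmax' (strict _ _ hk'k bk') (strict _ _ hl'k bl')
  · refine core l k k' l' (by rw [hGs]; exact hp) hp' (by linarith) (fun q hq => ?_)
      (strict _ _ hk'l bk') (strict _ _ hl'l bl')
    have := hmax' q hq; linarith
  · refine core k' l' k l hp' hp hcls (fun q hq => ?_)
      (strict _ _ (Ne.symm hk'k) bk) (strict _ _ (Ne.symm hk'l) bl)
    have := hmax' q hq; linarith
  · refine core l' k' k l (by rw [hGs]; exact hp') hp (by linarith) (fun q hq => ?_)
      (strict _ _ (Ne.symm hl'k) bk) (strict _ _ (Ne.symm hl'l) bl)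
    have := hmax' q hq; linarith


/-! ## The hypothesis `no mixed coincidence` is necessary -/

/-- At the MIXED wall `2δ₁ = δ₀ + δ₂` the first-order sieve passes: the pattern `−E₁₁ + ½(E₀₂ + E₂₀)` is
realisable (letters `E₁₁`-type null `S₀ = diag(1,0)`, `S₂ = diag(0,1)`, indefinite `S₁ = offdiag(1,1)`
`det`-orthogonal to both) and all its value classes vanish.  Hence the no-mixed-coincidence hypothesis of
`pureDSieve` cannot be dropped. [this work] -/
theorem pureDSieve_false_without_noMixed :
    ¬ ∀ (δ : Fin 6 → ℝ), Function.Injective δ → ∀ G : Matrix (Fin 6) (Fin 6) ℝ,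
      (∀ v : ℝ, (∑ k, ∑ l, if δ k + δ l = v then G k l else 0) = 0) →
      (∃ (ε : ℝ) (S : Fin 6 → Matrix (Fin 2) (Fin 2) ℝ), (ε = 1 ∨ ε = -1) ∧ (∀ l, (S l).IsSymm) ∧
        ∀ i j, G i j = ε * (((S i + S j).det - (S i).det - (S j).det) / 2)) → G = 0 := by
  intro h
  have key := h (![0, 1, 2, 5, 11, 23] : Fin 6 → ℝ) ?inj
    !![0, 0, 1/2, 0, 0, 0; 0, -1, 0, 0, 0, 0; 1/2, 0, 0, 0, 0, 0; 0, 0, 0, 0, 0, 0;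
       0, 0, 0, 0, 0, 0; 0, 0, 0, 0, 0, 0] ?sums
    ⟨1, ![!![1, 0; 0, 0], !![0, 1; 1, 0], !![0, 0; 0, 1], 0, 0, 0], Or.inl rfl, ?symm, ?gram⟩
  · have h11 := congrFun (congrFun key 1) 1
    norm_num at h11
  case inj =>
    intro i j hij
    fin_cases i <;> fin_cases j <;> first | rfl | (norm_num at hij)
  case sums =>
    intro v
    by_cases hv : v = 2
    · subst hv
      simp [Fin.sum_univ_succ]
      norm_num
    · have hv' : ¬ ((2 : ℝ) = v) := fun h => hv h.symm
      simp [Fin.sum_univ_succ]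
      norm_num [hv']
  case symm =>
    intro l
    fin_cases l <;> simp [Matrix.IsSymm] <;> (ext i j; fin_cases i <;> fin_cases j <;> simp)
  case gram =>
    intro i j
    fin_cases i <;> fin_cases j <;> norm_num [Matrix.det_fin_two]

end

end Summit.ValiantsHypothesis.ValiantsHypothesis.Theorems.LacunarySymmetroidMatrixDescartes.WallBubbling
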